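import Mathlib
import HarnessLib
import Literature.Computability.AlgebraicComplexity.MignonRessayreBound
import Literature.Computability.AlgebraicComplexity.HessianRank

/-!
# Additivity of the cut lemma along a CHAIN of cuts (line rank-dehn-ladder, NOL roadmap §5(e))

Crux `stmt-PneNP-18923` (`Summit.PneNP.PneNP.Theses.CnfIdealGenLength.RankDefectRepresentations`), line
`rank-dehn-ladder`, negative rung N1 (cut lemma) in the special case of NESTED cuts: rows and columns carry LEVELS
`rl x, cl y ≤ m`; the `k`-th threshold cut of `X` keeps the entries with `rl x < k ≤ cl y` or `cl y < k ≤ rl x`.  Then the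
off-diagonal part of `X` (entries with `rl x ≠ cl y`) has rank at most `2 ∑_{k=1}^{m} rank (cut_k X)` — the SHARP additive
form with an absolute constant (contrast: for `n` independent binary cuts this is the open `stub_cutLemma`; for one
`m`-valued Hamiltonian the Cauchy example loses a factor `Θ(m)`, `Lines/rank-dehn-ladder-NOL.md` §5(e)).  Proof: the rows of
level `a` of the upper part form a sub-block of `cut_{a+1}`; rank is subadditive over the row partition.
HONEST FRAMING: elementary linear algebra; P ≠ NP is not moved; F-N2 is a FRONTIER formal rung.
-/

set_option linter.dupNamespace false -- `Summit.PneNP.PneNP.…`: summit = sub-problem name (D-0017)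

namespace Summit.PneNP.PneNP.Theorems.CnfIdealGenLengthRankDefectRepresentationsChainCuts

open Finset
open Literature.Computability.AlgebraicComplexity (rank_sum_le rank_add_le)

variable {K : Type} [Field K] {ι ι' : Type}

/-- The upper part (entries with `rl x < cl y`) is the sum over levels `a ≤ m` of its level-`a` row blocks. -/
theorem upper_eq_sum (rl : ι → ℕ) (cl : ι' → ℕ) (m : ℕ) (hrl : ∀ x, rl x ≤ m) (X : Matrix ι ι' K) :
    (Matrix.of fun x y => if rl x < cl y then X x y else 0) =
      ∑ a ∈ range (m + 1), Matrix.of fun x y => if rl x = a ∧ a < cl y then X x y else 0 := by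
  ext x y
  simp only [Matrix.sum_apply, Matrix.of_apply]
  rw [Finset.sum_eq_single (rl x)]
  · by_cases h : rl x < cl y <;> simp [h]
  · intro a _ ha; rw [if_neg (fun h => ha h.1.symm)]
  · intro h; exact absurd (Finset.mem_range.mpr (Nat.lt_succ_of_le (hrl x))) h

/-- The lower part (entries with `cl y < rl x`) is the sum over levels `a ≤ m` of its level-`a` column blocks. -/
theorem lower_eq_sum (rl : ι → ℕ) (cl : ι' → ℕ) (m : ℕ) (hcl : ∀ y, cl y ≤ m) (X : Matrix ι ι' K) :
    (Matrix.of fun x y => if cl y < rl x then X x y else 0) =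
      ∑ a ∈ range (m + 1), Matrix.of fun x y => if cl y = a ∧ a < rl x then X x y else 0 := by
  ext x y
  simp only [Matrix.sum_apply, Matrix.of_apply]
  rw [Finset.sum_eq_single (cl y)]
  · by_cases h : cl y < rl x <;> simp [h]
  · intro a _ ha; rw [if_neg (fun h => ha h.1.symm)]
  · intro h; exact absurd (Finset.mem_range.mpr (Nat.lt_succ_of_le (hcl y))) h

/-- The level-`a` row block of the upper part is a row-compression of the threshold cut `a+1`. -/
theorem upper_block_eq [Fintype ι] [DecidableEq ι] (rl : ι → ℕ) (cl : ι' → ℕ) (a : ℕ) (X : Matrix ι ι' K) :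
    (Matrix.of fun x y => if rl x = a ∧ a < cl y then X x y else 0) =
      Matrix.diagonal (fun x => if rl x = a then (1 : K) else 0) *
        Matrix.of fun x y => if (rl x < a + 1 ∧ a + 1 ≤ cl y) ∨ (cl y < a + 1 ∧ a + 1 ≤ rl x) then X x y else 0 := by
  ext x y
  simp only [Matrix.diagonal_mul, Matrix.of_apply]
  by_cases h1 : rl x = a
  · by_cases h2 : a < cl y
    · rw [if_pos ⟨h1, h2⟩, if_pos h1, if_pos (Or.inl ⟨by omega, by omega⟩), one_mul]
    · rw [if_neg (fun h => h2 h.2), if_pos h1, if_neg (by omega), mul_zero]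
  · rw [if_neg (fun h => h1 h.1), if_neg h1, zero_mul]

/-- The level-`a` column block of the lower part is a column-compression of the threshold cut `a+1`. -/
theorem lower_block_eq [Fintype ι'] [DecidableEq ι'] (rl : ι → ℕ) (cl : ι' → ℕ) (a : ℕ) (X : Matrix ι ι' K) :
    (Matrix.of fun x y => if cl y = a ∧ a < rl x then X x y else 0) =
      (Matrix.of fun x y => if (rl x < a + 1 ∧ a + 1 ≤ cl y) ∨ (cl y < a + 1 ∧ a + 1 ≤ rl x) then X x y else 0) *
        Matrix.diagonal (fun y => if cl y = a then (1 : K) else 0) := by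
  ext x y
  simp only [Matrix.mul_diagonal, Matrix.of_apply]
  by_cases h1 : cl y = a
  · by_cases h2 : a < rl x
    · rw [if_pos ⟨h1, h2⟩, if_pos h1, if_pos (Or.inr ⟨by omega, by omega⟩), mul_one]
    · rw [if_neg (fun h => h2 h.2), if_pos h1, if_neg (by omega), zero_mul]
  · rw [if_neg (fun h => h1 h.1), if_neg h1, mul_zero]

/-- CHAIN-CUT ADDITIVITY: the off-diagonal part of `X` (w.r.t. levels `≤ m`) has rank at most twice the sum of the ranks
of the `m` threshold cuts. -/
theorem rank_offDiag_le_chainCuts [Fintype ι] [Fintype ι'] [DecidableEq ι] [DecidableEq ι'] (rl : ι → ℕ) (cl : ι' → ℕ) (m : ℕ) (hrl : ∀ x, rl x ≤ m) (hcl : ∀ y, cl y ≤ m)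
    (X : Matrix ι ι' K) :
    (Matrix.of fun x y => if rl x ≠ cl y then X x y else 0).rank ≤
      2 * ∑ a ∈ range (m + 1),
        (Matrix.of fun x y =>
          if (rl x < a + 1 ∧ a + 1 ≤ cl y) ∨ (cl y < a + 1 ∧ a + 1 ≤ rl x) then X x y else 0).rank := by
  have hsplit : (Matrix.of fun x y => if rl x ≠ cl y then X x y else 0) =
      (Matrix.of fun x y => if rl x < cl y then X x y else 0) +
        (Matrix.of fun x y => if cl y < rl x then X x y else 0) := by
    ext x y
    simp only [Matrix.add_apply, Matrix.of_apply]
    rcases Nat.lt_trichotomy (rl x) (cl y) with h | h | h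
    · rw [if_pos (Nat.ne_of_lt h), if_pos h, if_neg (Nat.lt_asymm h), add_zero]
    · rw [if_neg (fun h' => h' h), if_neg (by omega), if_neg (by omega), add_zero]
    · rw [if_pos (Nat.ne_of_gt h), if_neg (Nat.lt_asymm h), if_pos h, zero_add]
  rw [hsplit, upper_eq_sum rl cl m hrl, lower_eq_sum rl cl m hcl, two_mul]
  refine (rank_add_le _ _).trans (Nat.add_le_add ?_ ?_)
  · refine (rank_sum_le _ _).trans (Finset.sum_le_sum fun a _ => ?_)
    rw [upper_block_eq]; exact Matrix.rank_mul_le_right _ _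
  · refine (rank_sum_le _ _).trans (Finset.sum_le_sum fun a _ => ?_)
    rw [lower_block_eq]; exact Matrix.rank_mul_le_left _ _

end Summit.PneNP.PneNP.Theorems.CnfIdealGenLengthRankDefectRepresentationsChainCuts
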